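import Literature.Analysis.UnboundedOperators.VonNeumannDecomposition
import HarnessLib

/-!
# Self-adjoint extensions of a symmetric operator: the basic criterion and von Neumann's `T_V`

Library file (topic `Literature/Analysis/UnboundedOperators`), continuing
`VonNeumannDecomposition.lean` (`dom T† = dom T ∔ 𝒩₊ ∔ 𝒩₋`). Two definitions with bodies
(`twistedRange W V = {w + V w}`, `vnExtension T W V = T†|_{dom T + {w + V w}}`), theorems otherwise;
no named fact.

Sources followed (held copies read): D. E. Edmunds, W. D. Evans, *Spectral Theory and Differential
Operators*, 2nd ed. (2018), Ch. III §4: **Thm 4.2 (i)** "a symmetric `T` is self-adjoint iff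
`ℛ(T − λI) = ℛ(T − λ̄I) = H` for some, hence all, `λ ∉ ℝ`" (pdf p0122:L18–L24; for the `if` half no
condition on `λ` is needed, cf. (iii)) = Reed–Simon I **Thm VIII.3** (the basic criterion), and
**Thm 4.8** (pdf p0125:L13–p0126:L33): for a partial isometry `V : 𝒩₊ ⊇ 𝓘(V) → 𝒩₋` the operator
`T_V := T*|_{𝒟(T_V)}`, `𝒟(T_V) = {φ + φ₊ + Vφ₊ : φ ∈ 𝒟(T), φ₊ ∈ 𝓘(V)}` (4.10), is a symmetric
extension of `T`, with `ℛ(T_V + i) = ℛ(T + i) ⊕ 𝓘(V)` (4.14), `ℛ(T_V − i) = ℛ(T − i) ⊕ V𝓘(V)` (4.15),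
"`T_V` is self-adjoint if, and only if, `V` is a unitary map of `𝒩₊` onto `𝒩₋`", and every closed
symmetric (in particular every self-adjoint) extension `S` of `T` is a `T_V`, `V` being the isometry
`φ₊ ↦ φ₋` on `𝓘(V) = {φ₊ : φ₊ + φ₋ ∈ 𝒟(S) for some φ₋ ∈ 𝒩₋}` (4.13), isometric by
`0 = (Su,u) − (u,Su) = 2i(‖φ₊‖² − ‖φ₋‖²)` (4.12).

**Contents** (`T : H →ₗ.[ℂ] H` symmetric densely defined; `𝒩₊ = T†.eigenspace I`,
`𝒩₋ = T†.eigenspace (-I)`; here `V` is a linear isometry from a subspace `W ≤ 𝒩₊` into `H` with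
values in `𝒩₋` — Edmunds–Evans' partial isometry restricted to its initial set `𝓘(V) = W`):
* `isSelfAdjoint_of_isSymmetric_of_range_eq_top`, `isSelfAdjoint_iff_range_eq_top` — the basic
  criterion (over the tree's `subSMul T z = T − z` of `SelfAdjointResolvent.lean`);
* the boundary form of `T†`: `inner_adjoint_sub_eq_zero_left/right`, `boundaryForm_deficiency`,
  `boundaryForm_eq` (`⟪T†u, v⟫ − ⟪u, T†v⟫ = −2i(⟪a, a'⟫ − ⟪b, b'⟫)` on `u = φ + a + b`,
  `v = φ' + a' + b'`), and (4.12) `norm_eq_norm_of_mem_symmetric_extension`;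
* `vnExtension T W V` with `vnExtension_domain`, `mem_vnExtension_domain_iff`, `le_vnExtension`,
  `vnExtension_le_adjoint`, `vnExtension_apply` (`T_V(φ + w + Vw) = Tφ + iw − iVw`),
  `vnExtension_isSymmetric`, (4.14) `range_vnExtension_add_I`, (4.15) `range_vnExtension_sub_I`,
  and **`isSelfAdjoint_vnExtension_iff`** (`T_V` self-adjoint ⟺ `W = 𝒩₊ ∧ V(W) = 𝒩₋`, `T` closed);
* classification: `exists_partner_of_isSelfAdjoint`, `partner_unique`,
  **`exists_eq_vnExtension_of_isSelfAdjoint`** (every self-adjoint `S ⊇ T` is `T_V` with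
  `V : 𝒩₊ → 𝒩₋` an onto isometry) and `vnExtension_injective` (`V` is determined by `T_V`).
  (E.g. for deficiency indices `(n, n)` the self-adjoint extensions form a `U(n)`-family; this is the
  set Connes–Moscovici 2022 Thm 1.6 (iii) quantifies over for the prolate operator, `n = 4`.)
* symmetric extensions (first half of Thm 4.8 with (4.11) `m±(T_V) = m±(T) − dim 𝓘(V)`, added in a
  second pass): `le_adjoint_of_isSymmetric_of_le` (`T ⊂ S ⊂ S* ⊂ T*`),
  **`exists_eq_vnExtension_of_isSymmetric`** (every symmetric `S ⊇ T` is `T_V` for an isometry `V` on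
  a subspace `W ≤ 𝒩₊` into `𝒩₋` — the initial space (4.13)), `card_le_finrank_of_independent_mod`
  (`d` vectors of `dom T_V` independent modulo `dom T` ⟹ `d ≤ dim W`),
  **`isSelfAdjoint_of_isSymmetric_of_independent`** / `…_of_finrank_eq` (finite deficiency indices
  `m± ≤ d`: a symmetric extension containing `d` vectors independent modulo `dom T` is self-adjoint —
  the dimension-count road to self-adjointness used for Sturm–Liouville operators with finitely many
  boundary conditions), and maximality `eq_of_isSelfAdjoint_of_le_of_isSymmetric` /
  `eq_of_isSelfAdjoint_of_le` (a self-adjoint operator has no proper symmetric extension; the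
  «cannot be larger due to self-adjointness» step of Connes–Moscovici 2022 Thm 1.6 (iii));
  `card_le_finrank_deficiency_of_isSymmetric` (at most `m₊` vectors of a symmetric extension are
  independent modulo `dom T`) and **`existsUnique_coeffs_of_isSymmetric`** (`m₊` independent vectors
  span `dom S` modulo `dom T`, uniquely: `𝒟(S) = 𝒟(T) ∔ span{uᵢ}`);
* self-adjoint boundary conditions (Thm 4.9 (4.16)–(4.17) read as a construction):
  `boundaryForm_eq_zero_symm`, `boundaryForm_right_of_eq_add_sum`, and
  **`isSelfAdjoint_domRestrict_adjoint_of_annihilator`** — for `d ≥ m±` pairwise `β`-orthogonal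
  vectors `bₖ ∈ dom T†` independent modulo `dom T`, the restriction of `T†` to their `β`-annihilator is
  self-adjoint and the annihilator equals `dom T ∔ span{bₖ}` (the Lagrangian description of
  self-adjoint extensions used for Sturm–Liouville boundary conditions; instantiated for the prolate
  operator in `ConnesMoscovici2022/UVProlateVonNeumann.lean`).

## References
* D. E. Edmunds, W. D. Evans, *Spectral Theory and Differential Operators*, 2nd ed., Oxford (2018),
  Ch. III §4, Thm 4.2, Def 4.7, Thm 4.8 with (4.10)–(4.15) (held copy pdf p0122, p0125–p0126).
  [EdmundsEvans2018]
* M. Reed, B. Simon, *Methods of Modern Mathematical Physics I*, rev. ed. (1980), Thm VIII.3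
  (basic criterion for self-adjointness). [ReedSimonI1980]
-/

noncomputable section

open _root_.LinearPMap _root_.Filter _root_.Topology Complex
open scoped InnerProductSpace ComplexConjugate

namespace Literature.Analysis.UnboundedOperators

variable {H : Type*} [NormedAddCommGroup H] [InnerProductSpace ℂ H] [CompleteSpace H]
variable {T : H →ₗ.[ℂ] H}

/-! ### The basic criterion for self-adjointness -/

/-- **Basic criterion for self-adjointness**: a densely defined symmetric `T` with
`Ran (T − z) = Ran (T − z̄) = H` for some `z` is self-adjoint (no condition on `z`).
[cite: EdmundsEvans2018, Ch. III §4 Thm 4.2 (i)/(iii); ReedSimonI1980, Thm VIII.3] -/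
theorem isSelfAdjoint_of_isSymmetric_of_range_eq_top (hT : T.IsSymmetric) (hd : Dense (T.domain : Set H))
    {z : ℂ} (h1 : LinearMap.range (subSMul T z) = ⊤) (h2 : LinearMap.range (subSMul T (conj z)) = ⊤) :
    IsSelfAdjoint T := by
  have hle : T ≤ T† := le_adjoint_of_isSymmetric hT hd
  -- `ker (T† − z) = Ran (T − z̄)ᗮ = 0`
  have hker : T†.eigenspace z = ⊥ := by
    rw [← orthogonal_range_subSMul_eq_eigenspace hd z, h2, Submodule.top_orthogonal_eq_bot]
  -- `dom T† ≤ dom T`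
  have hdom : T†.domain ≤ T.domain := by
    intro u hu
    obtain ⟨v, hv⟩ := LinearMap.range_eq_top.1 h1 ((T† ⟨u, hu⟩ : H) - z • u)
    -- `u − v ∈ ker (T† − z)`
    have hvd : (v : H) ∈ T†.domain := hle.1 v.2
    have hTv : (T† ⟨v, hvd⟩ : H) = T v := (hle.2 rfl).symm
    have hmem : u - (v : H) ∈ T†.eigenspace z := by
      rw [LinearPMap.mem_eigenspace_iff]
      refine ⟨Submodule.sub_mem _ hu hvd, ?_⟩
      have e : (⟨u - (v : H), Submodule.sub_mem _ hu hvd⟩ : T†.domain) = ⟨u, hu⟩ - ⟨v, hvd⟩ := rfl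
      rw [e, LinearPMap.map_sub, hTv]
      rw [subSMul_apply] at hv
      rw [smul_sub, sub_eq_sub_iff_sub_eq_sub]
      exact hv.symm
    rw [hker, Submodule.mem_bot, sub_eq_zero] at hmem
    rw [hmem]; exact v.2
  rw [LinearPMap.isSelfAdjoint_def]
  exact (eq_of_le_of_domain_eq hle (le_antisymm hle.1 hdom)).symm

/-- The criterion as an equivalence for non-real `z`: a densely defined symmetric `T` is self-adjoint
iff `Ran (T − z) = Ran (T − z̄) = H`. [cite: EdmundsEvans2018, Ch. III §4 Thm 4.2 (i); ReedSimonI1980, Thm VIII.3] -/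
theorem isSelfAdjoint_iff_range_eq_top (hT : T.IsSymmetric) (hd : Dense (T.domain : Set H)) {z : ℂ}
    (hz : z.im ≠ 0) :
    IsSelfAdjoint T ↔ LinearMap.range (subSMul T z) = ⊤ ∧ LinearMap.range (subSMul T (conj z)) = ⊤ := by
  refine ⟨fun h => ⟨range_subSMul_eq_top h hz, range_subSMul_eq_top h (by simpa using hz)⟩,
    fun h => isSelfAdjoint_of_isSymmetric_of_range_eq_top hT hd h.1 h.2⟩

/-! ### The boundary form of `T†` on `dom T ∔ 𝒩₊ ∔ 𝒩₋` -/

/-- `⟪T† u, v⟫ − ⟪u, T† v⟫` vanishes when `v ∈ dom T` (the boundary form of `T†` is trivial on `dom T`).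
[cite: EdmundsEvans2018, Ch. III §4 Thm 4.8 (proof, display (4.12))] -/
theorem inner_adjoint_sub_eq_zero_right (hT : T.IsSymmetric) (hd : Dense (T.domain : Set H))
    (u : T†.domain) (v : T†.domain) (hv : (v : H) ∈ T.domain) :
    ⟪(T† u : H), (v : H)⟫_ℂ - ⟪(u : H), (T† v : H)⟫_ℂ = 0 := by
  have hle : T ≤ T† := le_adjoint_of_isSymmetric hT hd
  have hTv : (T† v : H) = T ⟨v, hv⟩ := (hle.2 rfl).symm
  rw [hTv, adjoint_isFormalAdjoint hd u ⟨v, hv⟩, sub_self]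

/-- `⟪T† u, v⟫ − ⟪u, T† v⟫` vanishes when `u ∈ dom T`. [cite: EdmundsEvans2018, Ch. III §4 Thm 4.8 (proof, display (4.12))] -/
theorem inner_adjoint_sub_eq_zero_left (hT : T.IsSymmetric) (hd : Dense (T.domain : Set H))
    (u : T†.domain) (v : T†.domain) (hu : (u : H) ∈ T.domain) :
    ⟪(T† u : H), (v : H)⟫_ℂ - ⟪(u : H), (T† v : H)⟫_ℂ = 0 := by
  have h := inner_adjoint_sub_eq_zero_right hT hd v u hu
  rw [sub_eq_zero] at h ⊢
  conv_lhs => rw [← inner_conj_symm]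
  rw [← h, inner_conj_symm]

/-- **The boundary form on the deficiency part**: for `a, a' ∈ 𝒩₊`, `b, b' ∈ 𝒩₋`,
`⟪T†(a + b), a' + b'⟫ − ⟪a + b, T†(a' + b')⟫ = −2i (⟪a, a'⟫ − ⟪b, b'⟫)` (polarised form of
Edmunds–Evans (4.12)). [cite: EdmundsEvans2018, Ch. III §4 Thm 4.8 (proof, (4.12))] -/
theorem boundaryForm_deficiency {a b a' b' : H} (ha : a ∈ T†.eigenspace I) (hb : b ∈ T†.eigenspace (-I))
    (ha' : a' ∈ T†.eigenspace I) (hb' : b' ∈ T†.eigenspace (-I))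
    (hab : a + b ∈ T†.domain) (hab' : a' + b' ∈ T†.domain) :
    ⟪(T† ⟨a + b, hab⟩ : H), a' + b'⟫_ℂ - ⟪a + b, (T† ⟨a' + b', hab'⟩ : H)⟫_ℂ =
      -2 * I * (⟪a, a'⟫_ℂ - ⟪b, b'⟫_ℂ) := by
  obtain ⟨had, hav⟩ := adjoint_apply_of_mem_eigenspace ha
  obtain ⟨hbd, hbv⟩ := adjoint_apply_of_mem_eigenspace hb
  obtain ⟨had', hav'⟩ := adjoint_apply_of_mem_eigenspace ha'
  obtain ⟨hbd', hbv'⟩ := adjoint_apply_of_mem_eigenspace hb'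
  have h1 : (T† ⟨a + b, hab⟩ : H) = I • a - I • b := by
    have e : (⟨a + b, hab⟩ : T†.domain) = ⟨a, had⟩ + ⟨b, hbd⟩ := rfl
    rw [e, LinearPMap.map_add, hav, hbv, neg_smul, ← sub_eq_add_neg]
  have h2 : (T† ⟨a' + b', hab'⟩ : H) = I • a' - I • b' := by
    have e : (⟨a' + b', hab'⟩ : T†.domain) = ⟨a', had'⟩ + ⟨b', hbd'⟩ := rfl
    rw [e, LinearPMap.map_add, hav', hbv', neg_smul, ← sub_eq_add_neg]
  rw [h1, h2]
  simp only [inner_add_left, inner_add_right, inner_sub_left, inner_sub_right, inner_smul_left,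
    inner_smul_right, Complex.conj_I]
  ring

/-- **The boundary form of `T†`**: for `u = φ + a + b`, `v = φ' + a' + b'` with `φ, φ' ∈ dom T`,
`a, a' ∈ 𝒩₊`, `b, b' ∈ 𝒩₋`: `⟪T† u, v⟫ − ⟪u, T† v⟫ = −2i (⟪a, a'⟫ − ⟪b, b'⟫)`.
[cite: EdmundsEvans2018, Ch. III §4 Thm 4.8 (proof, (4.12) polarised)] -/
theorem boundaryForm_eq (hT : T.IsSymmetric) (hd : Dense (T.domain : Set H))
    {φ a b φ' a' b' : H} (hφ : φ ∈ T.domain) (ha : a ∈ T†.eigenspace I) (hb : b ∈ T†.eigenspace (-I))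
    (hφ' : φ' ∈ T.domain) (ha' : a' ∈ T†.eigenspace I) (hb' : b' ∈ T†.eigenspace (-I))
    (hu : φ + a + b ∈ T†.domain) (hv : φ' + a' + b' ∈ T†.domain) :
    ⟪(T† ⟨φ + a + b, hu⟩ : H), φ' + a' + b'⟫_ℂ - ⟪φ + a + b, (T† ⟨φ' + a' + b', hv⟩ : H)⟫_ℂ =
      -2 * I * (⟪a, a'⟫_ℂ - ⟪b, b'⟫_ℂ) := by
  have hle : T ≤ T† := le_adjoint_of_isSymmetric hT hd
  have hφd : φ ∈ T†.domain := hle.1 hφ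
  have hφd' : φ' ∈ T†.domain := hle.1 hφ'
  have had := (adjoint_apply_of_mem_eigenspace ha).1
  have hbd := (adjoint_apply_of_mem_eigenspace hb).1
  have had' := (adjoint_apply_of_mem_eigenspace ha').1
  have hbd' := (adjoint_apply_of_mem_eigenspace hb').1
  have hab : a + b ∈ T†.domain := Submodule.add_mem _ had hbd
  have hab' : a' + b' ∈ T†.domain := Submodule.add_mem _ had' hbd'
  -- split `u = φ + (a + b)`, `v = φ' + (a' + b')` and expand bilinearly
  have eu : (⟨φ + a + b, hu⟩ : T†.domain) = ⟨φ, hφd⟩ + ⟨a + b, hab⟩ := by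
    apply Subtype.ext; change φ + a + b = φ + (a + b); abel
  have ev : (⟨φ' + a' + b', hv⟩ : T†.domain) = ⟨φ', hφd'⟩ + ⟨a' + b', hab'⟩ := by
    apply Subtype.ext; change φ' + a' + b' = φ' + (a' + b'); abel
  have e1 : φ + a + b = φ + (a + b) := by abel
  have e2 : φ' + a' + b' = φ' + (a' + b') := by abel
  rw [eu, ev, LinearPMap.map_add, LinearPMap.map_add]
  conv_lhs => rw [e1, e2]
  have z1 := inner_adjoint_sub_eq_zero_left hT hd ⟨φ, hφd⟩ ⟨φ', hφd'⟩ hφ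
  have z2 := inner_adjoint_sub_eq_zero_left hT hd ⟨φ, hφd⟩ ⟨a' + b', hab'⟩ hφ
  have z3 := inner_adjoint_sub_eq_zero_right hT hd ⟨a + b, hab⟩ ⟨φ', hφd'⟩ hφ'
  have z4 := boundaryForm_deficiency ha hb ha' hb' hab hab'
  simp only [inner_add_left, inner_add_right] at z1 z2 z3 z4 ⊢
  linear_combination z1 + z2 + z3 + z4

/-- **(4.12)** For a symmetric `S` with `T ≤ S ≤ T†` and `u = φ + a + b ∈ dom S` (`φ ∈ dom T`,
`a ∈ 𝒩₊`, `b ∈ 𝒩₋`): `‖a‖ = ‖b‖` ("`0 = (Su, u) − (u, Su) = 2i(‖φ₊‖² − ‖φ₋‖²)`").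
[cite: EdmundsEvans2018, Ch. III §4 Thm 4.8 (proof, (4.12))] -/
theorem norm_eq_norm_of_mem_symmetric_extension (hT : T.IsSymmetric) (hd : Dense (T.domain : Set H))
    {S : H →ₗ.[ℂ] H} (hS : S.IsSymmetric) (hST : S ≤ T†)
    {φ a b : H} (hφ : φ ∈ T.domain) (ha : a ∈ T†.eigenspace I) (hb : b ∈ T†.eigenspace (-I))
    (hu : φ + a + b ∈ S.domain) : ‖a‖ = ‖b‖ := by
  have hu' : φ + a + b ∈ T†.domain := hST.1 hu
  have hSu : (S ⟨φ + a + b, hu⟩ : H) = T† ⟨φ + a + b, hu'⟩ := hST.2 rfl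
  have hsym : ⟪(S ⟨φ + a + b, hu⟩ : H), φ + a + b⟫_ℂ = ⟪φ + a + b, (S ⟨φ + a + b, hu⟩ : H)⟫_ℂ :=
    hS ⟨φ + a + b, hu⟩ ⟨φ + a + b, hu⟩
  have hB := boundaryForm_eq hT hd hφ ha hb hφ ha hb hu' hu'
  rw [← hSu, hsym, sub_self] at hB
  -- `0 = −2i (‖a‖² − ‖b‖²)`
  have h0 : ⟪a, a⟫_ℂ - ⟪b, b⟫_ℂ = 0 := by
    have : (-2 * I : ℂ) ≠ 0 := by norm_num [Complex.ext_iff]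
    exact (mul_eq_zero.1 hB.symm).resolve_left this
  rw [sub_eq_zero, inner_self_eq_norm_sq_to_K, inner_self_eq_norm_sq_to_K] at h0
  have h0' : ‖a‖ ^ 2 = ‖b‖ ^ 2 := by exact_mod_cast h0
  exact (pow_left_inj₀ (norm_nonneg _) (norm_nonneg _) two_ne_zero).1 h0'

/-! ### The extension `T_V` attached to an isometry `V : W → 𝒩₋`, `W ≤ 𝒩₊` -/

section Extension

variable (T)

/-- The "twisted" subspace `{w + V w : w ∈ W}` of `H` attached to a linear isometry `V` on a
subspace `W` (the summand `{φ₊ + Vφ₊ : φ₊ ∈ 𝓘(V)}` of (4.10)). [cite: EdmundsEvans2018, Ch. III §4 Thm 4.8 (4.10)] -/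
def twistedRange (W : Submodule ℂ H) (V : W →ₗᵢ[ℂ] H) : Submodule ℂ H :=
  LinearMap.range (W.subtype + V.toLinearMap)

/-- **The extension `T_V`** of `T` attached to a linear isometry `V : W → H` (`W` a subspace of
`𝒩₊`, `V` valued in `𝒩₋`): the restriction of `T†` to `dom T + {w + V w : w ∈ W}` — Edmunds–Evans'
`T_V` with `𝓘(V) = W`, (4.10). [cite: EdmundsEvans2018, Ch. III §4 Thm 4.8 (4.10)] -/
def vnExtension (W : Submodule ℂ H) (V : W →ₗᵢ[ℂ] H) : H →ₗ.[ℂ] H :=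
  T†.domRestrict (T.domain ⊔ twistedRange W V)

variable {T}

omit [CompleteSpace H] in
/-- Membership in the twisted subspace: `x = w + V w`. [cite: EdmundsEvans2018, Ch. III §4 Thm 4.8 (4.10)] -/
theorem mem_twistedRange_iff {W : Submodule ℂ H} {V : W →ₗᵢ[ℂ] H} {x : H} :
    x ∈ twistedRange W V ↔ ∃ w : W, x = (w : H) + V w := by
  simp only [twistedRange, LinearMap.mem_range, LinearMap.add_apply, Submodule.subtype_apply,
    LinearIsometry.coe_toLinearMap, eq_comm]

omit [CompleteSpace H] in
/-- `w + V w` lies in the twisted subspace. [cite: EdmundsEvans2018, Ch. III §4 Thm 4.8 (4.10)] -/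
theorem add_mem_twistedRange {W : Submodule ℂ H} {V : W →ₗᵢ[ℂ] H} (w : W) :
    (w : H) + V w ∈ twistedRange W V :=
  mem_twistedRange_iff.2 ⟨w, rfl⟩

/-- `T_V ⊂ T†` (it is a restriction of `T†`). [cite: EdmundsEvans2018, Ch. III §4 Thm 4.8 ("the restriction of `T*` to `𝒟(T_V)`")] -/
theorem vnExtension_le_adjoint (W : Submodule ℂ H) (V : W →ₗᵢ[ℂ] H) : vnExtension T W V ≤ T† :=
  domRestrict_le

/-- The twisted subspace lies in `dom T†` when `W ≤ 𝒩₊` and `V` takes values in `𝒩₋`.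
[cite: EdmundsEvans2018, Ch. III §4 Thm 4.8 (4.10)] -/
theorem twistedRange_le_adjoint_domain {W : Submodule ℂ H} {V : W →ₗᵢ[ℂ] H}
    (hW : W ≤ T†.eigenspace I) (hV : ∀ w : W, (V w : H) ∈ T†.eigenspace (-I)) :
    twistedRange W V ≤ T†.domain := by
  intro x hx
  obtain ⟨w, rfl⟩ := mem_twistedRange_iff.1 hx
  exact Submodule.add_mem _ (eigenspace_adjoint_le_domain I (hW w.2))
    (eigenspace_adjoint_le_domain (-I) (hV w))

/-- `dom T_V = dom T + {w + V w}` ((4.10)). [cite: EdmundsEvans2018, Ch. III §4 Thm 4.8 (4.10)] -/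
theorem vnExtension_domain (hT : T.IsSymmetric) (hd : Dense (T.domain : Set H))
    {W : Submodule ℂ H} {V : W →ₗᵢ[ℂ] H}
    (hW : W ≤ T†.eigenspace I) (hV : ∀ w : W, (V w : H) ∈ T†.eigenspace (-I)) :
    (vnExtension T W V).domain = T.domain ⊔ twistedRange W V := by
  rw [vnExtension, domRestrict_domain]
  exact inf_eq_left.2 (sup_le (le_adjoint_of_isSymmetric hT hd).1 (twistedRange_le_adjoint_domain hW hV))

/-- `T ⊂ T_V`. [cite: EdmundsEvans2018, Ch. III §4 Thm 4.8 ("`T ⊂ T_V`")] -/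
theorem le_vnExtension (hT : T.IsSymmetric) (hd : Dense (T.domain : Set H))
    {W : Submodule ℂ H} {V : W →ₗᵢ[ℂ] H}
    (hW : W ≤ T†.eigenspace I) (hV : ∀ w : W, (V w : H) ∈ T†.eigenspace (-I)) :
    T ≤ vnExtension T W V := by
  have hle : T ≤ T† := le_adjoint_of_isSymmetric hT hd
  refine ⟨?_, ?_⟩
  · rw [vnExtension_domain hT hd hW hV]; exact le_sup_left
  · intro x y hxy
    have hyT : (y : H) ∈ T†.domain := (vnExtension_le_adjoint W V).1 y.2
    have e1 : (vnExtension T W V y : H) = T† ⟨y, hyT⟩ := (vnExtension_le_adjoint W V).2 rfl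
    have e2 : (T x : H) = T† ⟨y, hyT⟩ := hle.2 hxy
    rw [e1, e2]

/-- `dom T_V` is dense. [cite: EdmundsEvans2018, Ch. III §4 Thm 4.8] -/
theorem dense_vnExtension_domain (hT : T.IsSymmetric) (hd : Dense (T.domain : Set H))
    {W : Submodule ℂ H} {V : W →ₗᵢ[ℂ] H}
    (hW : W ≤ T†.eigenspace I) (hV : ∀ w : W, (V w : H) ∈ T†.eigenspace (-I)) :
    Dense ((vnExtension T W V).domain : Set H) :=
  hd.mono fun _ hx => (le_vnExtension hT hd hW hV).1 hx

/-- Elements of `dom T_V`: `x = φ + (w + V w)` ((4.10)). [cite: EdmundsEvans2018, Ch. III §4 Thm 4.8 (4.10)] -/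
theorem mem_vnExtension_domain_iff (hT : T.IsSymmetric) (hd : Dense (T.domain : Set H))
    {W : Submodule ℂ H} {V : W →ₗᵢ[ℂ] H}
    (hW : W ≤ T†.eigenspace I) (hV : ∀ w : W, (V w : H) ∈ T†.eigenspace (-I)) {x : H} :
    x ∈ (vnExtension T W V).domain ↔ ∃ φ ∈ T.domain, ∃ w : W, x = φ + ((w : H) + V w) := by
  rw [vnExtension_domain hT hd hW hV, Submodule.mem_sup]
  constructor
  · rintro ⟨φ, hφ, t, ht, rfl⟩
    obtain ⟨w, rfl⟩ := mem_twistedRange_iff.1 ht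
    exact ⟨φ, hφ, w, rfl⟩
  · rintro ⟨φ, hφ, w, rfl⟩
    exact ⟨φ, hφ, _, add_mem_twistedRange w, rfl⟩

/-- **The action of `T_V`**: `T_V (φ + w + V w) = T φ + i w − i V w` (`T_V = T*` on its domain).
[cite: EdmundsEvans2018, Ch. III §4 Thm 4.8 (proof: `Su = Tφ + iφ₊ − iφ₋`)] -/
theorem vnExtension_apply (hT : T.IsSymmetric) (hd : Dense (T.domain : Set H))
    {W : Submodule ℂ H} {V : W →ₗᵢ[ℂ] H}
    (hW : W ≤ T†.eigenspace I) (hV : ∀ w : W, (V w : H) ∈ T†.eigenspace (-I))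
    (φ : T.domain) (w : W) (hx : (φ : H) + ((w : H) + V w) ∈ (vnExtension T W V).domain) :
    (vnExtension T W V ⟨(φ : H) + ((w : H) + V w), hx⟩ : H) = (T φ : H) + (I • (w : H) - I • V w) := by
  have hle : T ≤ T† := le_adjoint_of_isSymmetric hT hd
  obtain ⟨hwd, hwv⟩ := adjoint_apply_of_mem_eigenspace (hW w.2)
  obtain ⟨hvd, hvv⟩ := adjoint_apply_of_mem_eigenspace (hV w)
  have hφd : (φ : H) ∈ T†.domain := hle.1 φ.2
  have hx' : (φ : H) + ((w : H) + V w) ∈ T†.domain := (vnExtension_le_adjoint W V).1 hx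
  have e0 : (vnExtension T W V ⟨_, hx⟩ : H) = T† ⟨_, hx'⟩ := (vnExtension_le_adjoint W V).2 rfl
  rw [e0]
  have e : (⟨(φ : H) + ((w : H) + V w), hx'⟩ : T†.domain) = ⟨φ, hφd⟩ + (⟨w, hwd⟩ + ⟨V w, hvd⟩) := rfl
  rw [e, LinearPMap.map_add, LinearPMap.map_add, hwv, hvv, ← hle.2 (rfl : ((φ : H)) = ((⟨φ, hφd⟩ :
    T†.domain) : H)), neg_smul, ← sub_eq_add_neg]

/-- **`T_V` is symmetric** (the boundary form vanishes on `dom T_V` because `V` is isometric — "it is an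
easy matter to check that `T_V` is symmetric"). [cite: EdmundsEvans2018, Ch. III §4 Thm 4.8 (proof)] -/
theorem vnExtension_isSymmetric (hT : T.IsSymmetric) (hd : Dense (T.domain : Set H))
    {W : Submodule ℂ H} {V : W →ₗᵢ[ℂ] H}
    (hW : W ≤ T†.eigenspace I) (hV : ∀ w : W, (V w : H) ∈ T†.eigenspace (-I)) :
    (vnExtension T W V).IsSymmetric := by
  intro x y
  obtain ⟨φ, hφ, w, hxe⟩ := (mem_vnExtension_domain_iff hT hd hW hV).1 x.2
  obtain ⟨φ', hφ', w', hye⟩ := (mem_vnExtension_domain_iff hT hd hW hV).1 y.2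
  have hxT : (x : H) ∈ T†.domain := (vnExtension_le_adjoint W V).1 x.2
  have hyT : (y : H) ∈ T†.domain := (vnExtension_le_adjoint W V).1 y.2
  have ex : (vnExtension T W V x : H) = T† ⟨x, hxT⟩ := (vnExtension_le_adjoint W V).2 rfl
  have ey : (vnExtension T W V y : H) = T† ⟨y, hyT⟩ := (vnExtension_le_adjoint W V).2 rfl
  rw [ex, ey, ← sub_eq_zero]
  have hu : φ + (w : H) + V w ∈ T†.domain := by rw [add_assoc, ← hxe]; exact hxT
  have hv : φ' + (w' : H) + V w' ∈ T†.domain := by rw [add_assoc, ← hye]; exact hyT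
  have hB := boundaryForm_eq hT hd hφ (hW w.2) (hV w) hφ' (hW w'.2) (hV w') hu hv
  rw [LinearIsometry.inner_map_map, Submodule.coe_inner, sub_self, mul_zero] at hB
  have e1 : (⟨x, hxT⟩ : T†.domain) = ⟨φ + (w : H) + V w, hu⟩ :=
    Subtype.ext (show (x : H) = φ + (w : H) + V w by rw [hxe, add_assoc])
  have e2 : (⟨y, hyT⟩ : T†.domain) = ⟨φ' + (w' : H) + V w', hv⟩ :=
    Subtype.ext (show (y : H) = φ' + (w' : H) + V w' by rw [hye, add_assoc])
  rw [e1, e2]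
  have ex' : (x : H) = φ + (w : H) + V w := by rw [hxe, add_assoc]
  have ey' : (y : H) = φ' + (w' : H) + V w' := by rw [hye, add_assoc]
  rw [ex', ey']
  exact hB

/-- **(4.14)** `Ran (T_V + i) = Ran (T + i) + W`: indeed `(T_V + i)(φ + w + Vw) = (T + i)φ + 2i w`.
[cite: EdmundsEvans2018, Ch. III §4 Thm 4.8 (4.14)] -/
theorem range_vnExtension_add_I (hT : T.IsSymmetric) (hd : Dense (T.domain : Set H))
    {W : Submodule ℂ H} {V : W →ₗᵢ[ℂ] H}
    (hW : W ≤ T†.eigenspace I) (hV : ∀ w : W, (V w : H) ∈ T†.eigenspace (-I)) :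
    LinearMap.range (subSMul (vnExtension T W V) (-I)) = LinearMap.range (subSMul T (-I)) ⊔ W := by
  have key : ∀ (φ : T.domain) (w : W) (hx : (φ : H) + ((w : H) + V w) ∈ (vnExtension T W V).domain),
      subSMul (vnExtension T W V) (-I) ⟨_, hx⟩ = subSMul T (-I) φ + (2 * I) • (w : H) := by
    intro φ w hx
    rw [subSMul_apply, subSMul_apply, vnExtension_apply hT hd hW hV φ w hx]
    simp only [neg_smul, smul_add, sub_neg_eq_add]
    module
  apply le_antisymm
  · rintro u ⟨x, rfl⟩
    obtain ⟨φ, hφ, w, hxe⟩ := (mem_vnExtension_domain_iff hT hd hW hV).1 x.2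
    have hx : (φ : H) + ((w : H) + V w) ∈ (vnExtension T W V).domain := hxe ▸ x.2
    have ex : x = ⟨_, hx⟩ := Subtype.ext hxe
    rw [ex, key ⟨φ, hφ⟩ w hx]
    exact Submodule.add_mem _ (Submodule.mem_sup_left (LinearMap.mem_range_self _ _))
      (Submodule.mem_sup_right (Submodule.smul_mem _ _ w.2))
  · apply sup_le
    · rintro u ⟨φ, rfl⟩
      have hx : ((φ : H) + (((0 : W) : H) + V 0)) ∈ (vnExtension T W V).domain :=
        (mem_vnExtension_domain_iff hT hd hW hV).2 ⟨φ, φ.2, 0, rfl⟩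
      refine ⟨⟨_, hx⟩, ?_⟩
      rw [key φ 0 hx]; simp
    · intro w hw
      have hx : (((0 : T.domain) : H) + (((⟨w, hw⟩ : W) : H) + V ⟨w, hw⟩)) ∈ (vnExtension T W V).domain :=
        (mem_vnExtension_domain_iff hT hd hW hV).2 ⟨0, Submodule.zero_mem _, ⟨w, hw⟩, rfl⟩
      refine ⟨(2 * I)⁻¹ • ⟨_, hx⟩, ?_⟩
      rw [LinearMap.map_smul, key 0 ⟨w, hw⟩ hx, LinearMap.map_zero, zero_add, smul_smul,
        inv_mul_cancel₀ (by norm_num : (2 : ℂ) * I ≠ 0), one_smul]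

/-- **(4.15)** `Ran (T_V − i) = Ran (T − i) + V(W)`: `(T_V − i)(φ + w + Vw) = (T − i)φ − 2i Vw`.
[cite: EdmundsEvans2018, Ch. III §4 Thm 4.8 (4.15)] -/
theorem range_vnExtension_sub_I (hT : T.IsSymmetric) (hd : Dense (T.domain : Set H))
    {W : Submodule ℂ H} {V : W →ₗᵢ[ℂ] H}
    (hW : W ≤ T†.eigenspace I) (hV : ∀ w : W, (V w : H) ∈ T†.eigenspace (-I)) :
    LinearMap.range (subSMul (vnExtension T W V) I) =
      LinearMap.range (subSMul T I) ⊔ LinearMap.range V.toLinearMap := by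
  have key : ∀ (φ : T.domain) (w : W) (hx : (φ : H) + ((w : H) + V w) ∈ (vnExtension T W V).domain),
      subSMul (vnExtension T W V) I ⟨_, hx⟩ = subSMul T I φ - (2 * I) • V w := by
    intro φ w hx
    rw [subSMul_apply, subSMul_apply, vnExtension_apply hT hd hW hV φ w hx]
    simp only [smul_add]
    module
  apply le_antisymm
  · rintro u ⟨x, rfl⟩
    obtain ⟨φ, hφ, w, hxe⟩ := (mem_vnExtension_domain_iff hT hd hW hV).1 x.2
    have hx : (φ : H) + ((w : H) + V w) ∈ (vnExtension T W V).domain := hxe ▸ x.2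
    have ex : x = ⟨_, hx⟩ := Subtype.ext hxe
    rw [ex, key ⟨φ, hφ⟩ w hx]
    exact Submodule.sub_mem _ (Submodule.mem_sup_left (LinearMap.mem_range_self _ _))
      (Submodule.mem_sup_right (Submodule.smul_mem _ _ (LinearMap.mem_range_self _ w)))
  · apply sup_le
    · rintro u ⟨φ, rfl⟩
      have hx : ((φ : H) + (((0 : W) : H) + V 0)) ∈ (vnExtension T W V).domain :=
        (mem_vnExtension_domain_iff hT hd hW hV).2 ⟨φ, φ.2, 0, rfl⟩
      refine ⟨⟨_, hx⟩, ?_⟩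
      rw [key φ 0 hx]; simp
    · rintro u ⟨w, rfl⟩
      have hx : (((0 : T.domain) : H) + ((w : H) + V w)) ∈ (vnExtension T W V).domain :=
        (mem_vnExtension_domain_iff hT hd hW hV).2 ⟨0, Submodule.zero_mem _, w, rfl⟩
      refine ⟨(-(2 * I))⁻¹ • ⟨_, hx⟩, ?_⟩
      rw [LinearMap.map_smul, key 0 w hx, LinearMap.map_zero, zero_sub, ← neg_smul, smul_smul,
        inv_mul_cancel₀ (by norm_num : -((2 : ℂ) * I) ≠ 0), one_smul]
      rfl

omit [CompleteSpace H] in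
/-- A subspace of `Kᗮ` which together with `K` spans `H` is all of `Kᗮ` (the step from (4.14) to
"`𝓘(V) = 𝒩₊`"). [cite: EdmundsEvans2018, Ch. III §4 Thm 4.8 (proof, after (4.15))] -/
theorem eq_orthogonal_of_sup_eq_top {K W : Submodule ℂ H} (hW : W ≤ Kᗮ) (h : K ⊔ W = ⊤) : W = Kᗮ := by
  refine le_antisymm hW fun n hn => ?_
  have : n ∈ K ⊔ W := by rw [h]; trivial
  obtain ⟨k, hk, w, hw, rfl⟩ := Submodule.mem_sup.1 this
  have hk' : k ∈ Kᗮ := by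
    have : k = (k + w) - w := by abel
    rw [this]; exact Submodule.sub_mem _ hn (hW hw)
  have hk0 : k = 0 := by
    have : k ∈ K ⊓ Kᗮ := ⟨hk, hk'⟩
    rwa [Submodule.inf_orthogonal_eq_bot, Submodule.mem_bot] at this
  rw [hk0, zero_add]; exact hw

/-- **`T_V` is self-adjoint iff `V` is a unitary of `𝒩₊` onto `𝒩₋`**, i.e. iff `W = 𝒩₊` and
`V(W) = 𝒩₋` (for a CLOSED symmetric densely defined `T`; via the basic criterion and (4.14)–(4.15)).
[cite: EdmundsEvans2018, Ch. III §4 Thm 4.8 ("`T_V` is self-adjoint iff `V` is unitary from `𝒩₊` onto `𝒩₋`")] -/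
theorem isSelfAdjoint_vnExtension_iff (hT : T.IsSymmetric) (hc : T.IsClosed) (hd : Dense (T.domain : Set H))
    {W : Submodule ℂ H} {V : W →ₗᵢ[ℂ] H}
    (hW : W ≤ T†.eigenspace I) (hV : ∀ w : W, (V w : H) ∈ T†.eigenspace (-I)) :
    IsSelfAdjoint (vnExtension T W V) ↔
      W = T†.eigenspace I ∧ LinearMap.range V.toLinearMap = T†.eigenspace (-I) := by
  have hsym := vnExtension_isSymmetric hT hd hW hV
  have hdd := dense_vnExtension_domain hT hd hW hV
  have hVle : LinearMap.range V.toLinearMap ≤ T†.eigenspace (-I) := by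
    rintro _ ⟨w, rfl⟩; exact hV w
  rw [isSelfAdjoint_iff_range_eq_top hsym hdd (z := -I) (by simp), _root_.map_neg, Complex.conj_I,
    neg_neg, range_vnExtension_add_I hT hd hW hV, range_vnExtension_sub_I hT hd hW hV]
  constructor
  · rintro ⟨h1, h2⟩
    refine ⟨?_, ?_⟩
    · rw [← orthogonal_range_add_I_eq hd] at hW ⊢
      exact eq_orthogonal_of_sup_eq_top hW h1
    · rw [← orthogonal_range_sub_I_eq hd] at hVle ⊢
      exact eq_orthogonal_of_sup_eq_top hVle h2
  · rintro ⟨h1, h2⟩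
    have hK1 : IsClosed (LinearMap.range (subSMul T (-I)) : Set H) :=
      isClosed_range_subSMul_of_isSymmetric hT hc (by simp)
    have hK2 : IsClosed (LinearMap.range (subSMul T I) : Set H) :=
      isClosed_range_subSMul_of_isSymmetric hT hc (by simp)
    haveI : CompleteSpace (LinearMap.range (subSMul T (-I))) := hK1.completeSpace_coe
    haveI : CompleteSpace (LinearMap.range (subSMul T I)) := hK2.completeSpace_coe
    refine ⟨?_, ?_⟩
    · rw [h1, ← orthogonal_range_add_I_eq hd]; exact Submodule.sup_orthogonal_of_hasOrthogonalProjection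
    · rw [h2, ← orthogonal_range_sub_I_eq hd]; exact Submodule.sup_orthogonal_of_hasOrthogonalProjection

end Extension

/-! ### Every self-adjoint extension is a `T_V` with `V : 𝒩₊ → 𝒩₋` unitary -/

section Classification

variable {S : H →ₗ.[ℂ] H}

/-- A self-adjoint extension of a densely defined `T` sits below `T†`: `T ⊂ S = S* ⊂ T*`.
[cite: EdmundsEvans2018, Ch. III §4 Thm 4.8 (proof, first line)] -/
theorem le_adjoint_of_isSelfAdjoint_of_le (hd : Dense (T.domain : Set H)) (hTS : T ≤ S)
    (hS : IsSelfAdjoint S) : S ≤ T† := by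
  have h := adjoint_le_adjoint_of_le hd hTS
  rwa [LinearPMap.isSelfAdjoint_def.1 hS] at h

omit [CompleteSpace H] in
/-- Two restrictions of the same operator with the same domain coincide (both are `T*|_𝒟`).
[cite: EdmundsEvans2018, Ch. III §4 Thm 4.8 (4.10)] -/
theorem eq_of_le_of_le_of_domain_eq {f g h : H →ₗ.[ℂ] H} (hf : f ≤ h) (hg : g ≤ h)
    (heq : f.domain = g.domain) : f = g := by
  refine eq_of_le_of_domain_eq ⟨heq.le, fun x y hxy => ?_⟩ heq
  have hyh : (y : H) ∈ h.domain := hg.1 y.2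
  have e1 : f x = h ⟨y, hyh⟩ := hf.2 hxy
  have e2 : g y = h ⟨y, hyh⟩ := hg.2 rfl
  rw [e1, e2]

/-- For a self-adjoint extension `S ⊇ T`: every `n ∈ 𝒩₊` has a partner `m ∈ 𝒩₋` with `n + m ∈ dom S`
(take `ψ ∈ dom S` with `(S + i)ψ = 2i n`, `m := ψ − n`; i.e. `𝓘(V) = 𝒩₊` for self-adjoint `S`).
[cite: EdmundsEvans2018, Ch. III §4 Thm 4.8 (4.13)–(4.14)] -/
theorem exists_partner_of_isSelfAdjoint (hd : Dense (T.domain : Set H))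
    (hTS : T ≤ S) (hS : IsSelfAdjoint S) {n : H} (hn : n ∈ T†.eigenspace I) :
    ∃ m ∈ T†.eigenspace (-I), n + m ∈ S.domain := by
  have hST : S ≤ T† := le_adjoint_of_isSelfAdjoint_of_le hd hTS hS
  obtain ⟨ψ, hψ⟩ := subSMul_surjective hS (z := -I) (by simp) ((2 * I) • n)
  obtain ⟨hnd, hnv⟩ := adjoint_apply_of_mem_eigenspace hn
  have hψd : (ψ : H) ∈ T†.domain := hST.1 ψ.2
  have hSψ : (S ψ : H) = T† ⟨ψ, hψd⟩ := hST.2 rfl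
  refine ⟨(ψ : H) - n, ?_, by rw [add_sub_cancel]; exact ψ.2⟩
  rw [LinearPMap.mem_eigenspace_iff]
  refine ⟨Submodule.sub_mem _ hψd hnd, ?_⟩
  have e : (⟨(ψ : H) - n, Submodule.sub_mem _ hψd hnd⟩ : T†.domain) = ⟨ψ, hψd⟩ - ⟨n, hnd⟩ := rfl
  rw [e, LinearPMap.map_sub, hnv, ← hSψ]
  rw [subSMul_apply] at hψ
  -- hψ : S ψ - (-I) • ψ = (2 * I) • n
  rw [sub_eq_iff_eq_add] at hψ
  rw [hψ]
  module

/-- uniqueness of the partner: if `m, m' ∈ 𝒩₋` and `n + m, n + m' ∈ dom S` (`S` symmetric, `S ≤ T†`)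
then `m = m'` (by (4.12) applied to `m − m' ∈ dom S ∩ 𝒩₋`; `V` of (4.13) is well defined).
[cite: EdmundsEvans2018, Ch. III §4 Thm 4.8 (4.12)–(4.13)] -/
theorem partner_unique (hT : T.IsSymmetric) (hd : Dense (T.domain : Set H))
    (hSs : S.IsSymmetric) (hST : S ≤ T†) {n m m' : H}
    (hm : m ∈ T†.eigenspace (-I)) (hm' : m' ∈ T†.eigenspace (-I))
    (h1 : n + m ∈ S.domain) (h2 : n + m' ∈ S.domain) : m = m' := by
  have hdiff : (0 : H) + 0 + (m - m') ∈ S.domain := by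
    have : (0 : H) + 0 + (m - m') = (n + m) - (n + m') := by abel
    rw [this]; exact Submodule.sub_mem _ h1 h2
  have h := norm_eq_norm_of_mem_symmetric_extension hT hd hSs hST (Submodule.zero_mem _)
    (Submodule.zero_mem _) (Submodule.sub_mem _ hm hm') hdiff
  rw [norm_zero, eq_comm, norm_eq_zero, sub_eq_zero] at h
  exact h

/-- **Classification of self-adjoint extensions**: for a closed symmetric densely defined `T`, every
self-adjoint `S` with `T ⊂ S` is `T_V` for a linear isometry `V` of `𝒩₊` ONTO `𝒩₋`
(`V n` = the unique `m ∈ 𝒩₋` with `n + m ∈ dom S`, (4.13)). [cite: EdmundsEvans2018, Ch. III §4 Thm 4.8] -/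
theorem exists_eq_vnExtension_of_isSelfAdjoint (hT : T.IsSymmetric) (hc : T.IsClosed)
    (hd : Dense (T.domain : Set H)) (hTS : T ≤ S) (hS : IsSelfAdjoint S) :
    ∃ V : ↥(T†.eigenspace I) →ₗᵢ[ℂ] H,
      (∀ n, (V n : H) ∈ T†.eigenspace (-I)) ∧
      LinearMap.range V.toLinearMap = T†.eigenspace (-I) ∧
      S = vnExtension T (T†.eigenspace I) V := by
  have hST : S ≤ T† := le_adjoint_of_isSelfAdjoint_of_le hd hTS hS
  have hSs : S.IsSymmetric := hS.isSymmetric_linearPMap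
  -- the partner map
  choose f hf1 hf2 using fun n : ↥(T†.eigenspace I) => exists_partner_of_isSelfAdjoint hd hTS hS n.2
  have hadd : ∀ n n' : ↥(T†.eigenspace I), f (n + n') = f n + f n' := by
    intro n n'
    refine partner_unique hT hd hSs hST (hf1 _) (Submodule.add_mem _ (hf1 n) (hf1 n')) (hf2 _) ?_
    have : ((n + n' : ↥(T†.eigenspace I)) : H) + (f n + f n') = ((n : H) + f n) + ((n' : H) + f n') := by
      rw [Submodule.coe_add]; abel
    rw [this]; exact Submodule.add_mem _ (hf2 n) (hf2 n')
  have hsmul : ∀ (c : ℂ) (n : ↥(T†.eigenspace I)), f (c • n) = c • f n := by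
    intro c n
    refine partner_unique hT hd hSs hST (hf1 _) (Submodule.smul_mem _ c (hf1 n)) (hf2 _) ?_
    have : ((c • n : ↥(T†.eigenspace I)) : H) + c • f n = c • ((n : H) + f n) := by
      rw [Submodule.coe_smul, smul_add]
    rw [this]; exact Submodule.smul_mem _ c (hf2 n)
  have hnorm : ∀ n : ↥(T†.eigenspace I), ‖f n‖ = ‖(n : H)‖ := by
    intro n
    have h0 : (0 : H) + n + f n ∈ S.domain := by rw [zero_add]; exact hf2 n
    exact (norm_eq_norm_of_mem_symmetric_extension hT hd hSs hST (Submodule.zero_mem _) n.2 (hf1 n) h0).symm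
  let V : ↥(T†.eigenspace I) →ₗᵢ[ℂ] H :=
    { toFun := f
      map_add' := hadd
      map_smul' := hsmul
      norm_map' := fun n => by
        change ‖f n‖ = ‖n‖
        rw [hnorm, Submodule.coe_norm] }
  have hVf : ∀ n, V n = f n := fun n => rfl
  have hV : ∀ n, (V n : H) ∈ T†.eigenspace (-I) := fun n => hf1 n
  -- `S = T_V`: both are restrictions of `T†`, with the same domain
  have hdom : S.domain = (vnExtension T (T†.eigenspace I) V).domain := by
    rw [vnExtension_domain hT hd le_rfl hV]
    apply le_antisymm
    · intro u hu
      obtain ⟨φ, hφ, a, ha, b, hb, rfl⟩ := exists_vonNeumann_decomposition hT hc hd (hST.1 hu)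
      -- `b = V a`
      have hab : a + b ∈ S.domain := by
        have : a + b = (φ + a + b) - φ := by abel
        rw [this]; exact Submodule.sub_mem _ hu (hTS.1 hφ)
      have hba : b = f ⟨a, ha⟩ := partner_unique hT hd hSs hST hb (hf1 _) hab (hf2 ⟨a, ha⟩)
      rw [add_assoc]
      refine Submodule.add_mem_sup hφ (mem_twistedRange_iff.2 ⟨⟨a, ha⟩, ?_⟩)
      rw [hVf, ← hba]
    · refine sup_le hTS.1 ?_
      intro x hx
      obtain ⟨n, rfl⟩ := mem_twistedRange_iff.1 hx
      exact hf2 n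
  have hSeq : S = vnExtension T (T†.eigenspace I) V :=
    eq_of_le_of_le_of_domain_eq hST (vnExtension_le_adjoint _ V) hdom
  refine ⟨V, hV, ?_, hSeq⟩
  have hsa : IsSelfAdjoint (vnExtension T (T†.eigenspace I) V) := hSeq ▸ hS
  exact ((isSelfAdjoint_vnExtension_iff hT hc hd le_rfl hV).1 hsa).2

/-- **Uniqueness of the isometry**: `T_V = T_{V'}` (`V, V'` on all of `𝒩₊`) forces `V = V'` — the
correspondence of Thm 4.8 is one-one. [cite: EdmundsEvans2018, Ch. III §4 Thm 4.8 ("one-one correspondence")] -/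
theorem vnExtension_injective (hT : T.IsSymmetric) (hd : Dense (T.domain : Set H))
    {V V' : ↥(T†.eigenspace I) →ₗᵢ[ℂ] H}
    (hV : ∀ n, (V n : H) ∈ T†.eigenspace (-I)) (hV' : ∀ n, (V' n : H) ∈ T†.eigenspace (-I))
    (h : vnExtension T (T†.eigenspace I) V = vnExtension T (T†.eigenspace I) V') : V = V' := by
  apply LinearIsometry.ext
  intro n
  have hmem : (n : H) + V n ∈ (vnExtension T (T†.eigenspace I) V').domain := by
    rw [← h, vnExtension_domain hT hd le_rfl hV]
    exact Submodule.mem_sup_right (add_mem_twistedRange n)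
  obtain ⟨φ, hφ, m, he⟩ := (mem_vnExtension_domain_iff hT hd le_rfl hV').1 hmem
  -- `(-φ) + (n - m) + (V n - V' m) = 0`
  have hsum : (-φ) + ((n : H) - m) + (V n - V' m) = 0 := by
    have := he
    linear_combination (norm := skip) this
    abel
  have hu := vonNeumann_decomposition_unique hT hd (Submodule.neg_mem _ hφ)
    (Submodule.sub_mem _ n.2 m.2) (Submodule.sub_mem _ (hV n) (hV' m)) hsum
  have hnm : n = m := Subtype.ext (sub_eq_zero.1 hu.2.1)
  rw [hnm]
  exact sub_eq_zero.1 (hnm ▸ hu.2.2)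

end Classification

/-! ### Symmetric extensions: `S = T_V` for an isometry on a subspace of `𝒩₊`; self-adjointness by
dimension count; maximality of self-adjoint operators -/

section SymmetricExtension

variable {S : H →ₗ.[ℂ] H}

/-- A symmetric extension `S ⊇ T` of a densely defined `T` sits below `T†`: `T ⊂ S ⊂ S* ⊂ T*`.
[cite: EdmundsEvans2018, Ch. III §4 Thm 4.8 (proof, first line)] -/
theorem le_adjoint_of_isSymmetric_of_le (hd : Dense (T.domain : Set H)) (hTS : T ≤ S)
    (hS : S.IsSymmetric) : S ≤ T† := by
  have hdS : Dense (S.domain : Set H) := hd.mono fun _ hx => hTS.1 hx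
  exact (le_adjoint_of_isSymmetric hS hdS).trans (adjoint_le_adjoint_of_le hd hTS)

/-- **Every symmetric extension is a `T_V`** (first half of Thm 4.8): for a closed symmetric densely
defined `T` and a symmetric `S ⊇ T` there are a subspace `W ≤ 𝒩₊` — the initial space (4.13)
`𝓘(V) = {φ₊ ∈ 𝒩₊ : φ₊ + φ₋ ∈ dom S for some φ₋ ∈ 𝒩₋}` — and a linear isometry `V : W → 𝒩₋`
(`V φ₊ = φ₋`, well defined and isometric by (4.12)) with `S = T_V`.
[cite: EdmundsEvans2018, Ch. III §4 Thm 4.8 (4.10), (4.12)–(4.13)] -/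
theorem exists_eq_vnExtension_of_isSymmetric (hT : T.IsSymmetric) (hc : T.IsClosed)
    (hd : Dense (T.domain : Set H)) (hTS : T ≤ S) (hS : S.IsSymmetric) :
    ∃ (W : Submodule ℂ H) (V : W →ₗᵢ[ℂ] H), W ≤ T†.eigenspace I ∧
      (∀ w, (V w : H) ∈ T†.eigenspace (-I)) ∧ S = vnExtension T W V := by
  have hST : S ≤ T† := le_adjoint_of_isSymmetric_of_le hd hTS hS
  -- the initial space (4.13)
  let W : Submodule ℂ H :=
    { carrier := {a | a ∈ T†.eigenspace I ∧ ∃ b ∈ T†.eigenspace (-I), a + b ∈ S.domain}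
      add_mem' := by
        rintro a a' ⟨ha, b, hb, hab⟩ ⟨ha', b', hb', hab'⟩
        refine ⟨Submodule.add_mem _ ha ha', b + b', Submodule.add_mem _ hb hb', ?_⟩
        have : a + a' + (b + b') = (a + b) + (a' + b') := by abel
        rw [this]
        exact Submodule.add_mem _ hab hab'
      zero_mem' := ⟨Submodule.zero_mem _, 0, Submodule.zero_mem _, by
        rw [add_zero]; exact Submodule.zero_mem _⟩
      smul_mem' := by
        rintro c a ⟨ha, b, hb, hab⟩
        refine ⟨Submodule.smul_mem _ c ha, c • b, Submodule.smul_mem _ c hb, ?_⟩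
        rw [← smul_add]
        exact Submodule.smul_mem _ c hab }
  have hWle : W ≤ T†.eigenspace I := fun a ha => ha.1
  -- the partner map `V φ₊ = φ₋` on `W`
  choose f hf1 hf2 using fun a : W => a.2.2
  have hadd : ∀ a a' : W, f (a + a') = f a + f a' := by
    intro a a'
    refine partner_unique hT hd hS hST (hf1 _) (Submodule.add_mem _ (hf1 a) (hf1 a')) (hf2 _) ?_
    have : ((a + a' : W) : H) + (f a + f a') = ((a : H) + f a) + ((a' : H) + f a') := by
      rw [Submodule.coe_add]; abel
    rw [this]; exact Submodule.add_mem _ (hf2 a) (hf2 a')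
  have hsmul : ∀ (c : ℂ) (a : W), f (c • a) = c • f a := by
    intro c a
    refine partner_unique hT hd hS hST (hf1 _) (Submodule.smul_mem _ c (hf1 a)) (hf2 _) ?_
    have : ((c • a : W) : H) + c • f a = c • ((a : H) + f a) := by
      rw [Submodule.coe_smul, smul_add]
    rw [this]; exact Submodule.smul_mem _ c (hf2 a)
  have hnorm : ∀ a : W, ‖f a‖ = ‖(a : H)‖ := by
    intro a
    have h0 : (0 : H) + a + f a ∈ S.domain := by rw [zero_add]; exact hf2 a
    exact (norm_eq_norm_of_mem_symmetric_extension hT hd hS hST (Submodule.zero_mem _) (hWle a.2)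
      (hf1 a) h0).symm
  let V : W →ₗᵢ[ℂ] H :=
    { toFun := f
      map_add' := hadd
      map_smul' := hsmul
      norm_map' := fun a => by
        change ‖f a‖ = ‖a‖
        rw [hnorm, Submodule.coe_norm] }
  have hVf : ∀ a, V a = f a := fun a => rfl
  have hV : ∀ a, (V a : H) ∈ T†.eigenspace (-I) := fun a => hf1 a
  -- `S = T_V`: both are restrictions of `T†` with the same domain
  have hdom : S.domain = (vnExtension T W V).domain := by
    rw [vnExtension_domain hT hd hWle hV]
    apply le_antisymm
    · intro u hu
      obtain ⟨φ, hφ, a, ha, b, hb, rfl⟩ := exists_vonNeumann_decomposition hT hc hd (hST.1 hu)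
      have hab : a + b ∈ S.domain := by
        have : a + b = (φ + a + b) - φ := by abel
        rw [this]; exact Submodule.sub_mem _ hu (hTS.1 hφ)
      have haW : a ∈ W := ⟨ha, b, hb, hab⟩
      have hba : b = f ⟨a, haW⟩ := partner_unique hT hd hS hST hb (hf1 _) hab (hf2 ⟨a, haW⟩)
      rw [add_assoc]
      refine Submodule.add_mem_sup hφ (mem_twistedRange_iff.2 ⟨⟨a, haW⟩, ?_⟩)
      rw [hVf, ← hba]
    · refine sup_le hTS.1 ?_
      intro x hx
      obtain ⟨a, rfl⟩ := mem_twistedRange_iff.1 hx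
      exact hf2 a
  exact ⟨W, V, hWle, hV, eq_of_le_of_le_of_domain_eq hST (vnExtension_le_adjoint _ V) hdom⟩

/-- **`dim (dom T_V / dom T) = dim 𝓘(V)`**, in the inequality form used below: `d` vectors of `dom T_V`
linearly independent modulo `dom T` force `d ≤ dim W` (their `W`-components are linearly
independent). [cite: EdmundsEvans2018, Ch. III §4 Thm 4.8 (4.10)–(4.11)] -/
theorem card_le_finrank_of_independent_mod (hT : T.IsSymmetric) (hd : Dense (T.domain : Set H))
    {W : Submodule ℂ H} {V : W →ₗᵢ[ℂ] H}
    (hW : W ≤ T†.eigenspace I) (hV : ∀ w : W, (V w : H) ∈ T†.eigenspace (-I))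
    [FiniteDimensional ℂ W] {d : ℕ} (u : Fin d → H) (hu : ∀ i, u i ∈ (vnExtension T W V).domain)
    (hind : ∀ c : Fin d → ℂ, ∑ i, c i • u i ∈ T.domain → c = 0) : d ≤ Module.finrank ℂ W := by
  choose φ hφ w hw using fun i => (mem_vnExtension_domain_iff hT hd hW hV).1 (hu i)
  -- `hw i : u i = φ i + (w i + V (w i))`
  have hli : LinearIndependent ℂ w := by
    rw [Fintype.linearIndependent_iff]
    intro c hc i
    have hsum : ∑ j, c j • u j = ∑ j, c j • φ j + (((∑ j, c j • w j : W) : H) + V (∑ j, c j • w j)) := by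
      rw [_root_.map_sum, Submodule.coe_sum, ← Finset.sum_add_distrib, ← Finset.sum_add_distrib]
      refine Finset.sum_congr rfl fun j _ => ?_
      rw [hw j, LinearIsometry.map_smul, Submodule.coe_smul, smul_add, smul_add]
    have hmem : ∑ j, c j • u j ∈ T.domain := by
      rw [hsum, hc, _root_.map_zero, Submodule.coe_zero, add_zero, add_zero]
      exact Submodule.sum_mem _ fun j _ => Submodule.smul_mem _ _ (hφ j)
    exact congrFun (hind c hmem) i
  simpa using hli.fintype_card_le_finrank

/-- **Self-adjointness by dimension count** (finite deficiency indices): a symmetric extension `S` of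
a closed symmetric densely defined `T` containing `d` vectors linearly independent modulo `dom T`, with
`m₊(T) ≤ d` and `m₋(T) ≤ d`, is self-adjoint.  By Thm 4.8, `S = T_V` with `dim 𝓘(V) ≥ d ≥ m₊`, so
`𝓘(V) = 𝒩₊`, and `dim V𝓘(V) = dim 𝓘(V) ≥ m₋` gives `V𝓘(V) = 𝒩₋` ((4.11): `m±(T_V) = 0`): `V` is a
unitary map of `𝒩₊` onto `𝒩₋`, hence `T_V` is self-adjoint.
[cite: EdmundsEvans2018, Ch. III §4 Thm 4.8 with (4.11)] -/
theorem isSelfAdjoint_of_isSymmetric_of_independent (hT : T.IsSymmetric) (hc : T.IsClosed)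
    (hd : Dense (T.domain : Set H))
    [FiniteDimensional ℂ (T†.eigenspace I)] [FiniteDimensional ℂ (T†.eigenspace (-I))]
    (hTS : T ≤ S) (hS : S.IsSymmetric) {d : ℕ}
    (hp : Module.finrank ℂ (T†.eigenspace I) ≤ d) (hm : Module.finrank ℂ (T†.eigenspace (-I)) ≤ d)
    (u : Fin d → H) (hu : ∀ i, u i ∈ S.domain)
    (hind : ∀ c : Fin d → ℂ, ∑ i, c i • u i ∈ T.domain → c = 0) : IsSelfAdjoint S := by
  obtain ⟨W, V, hW, hV, rfl⟩ := exists_eq_vnExtension_of_isSymmetric hT hc hd hTS hS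
  haveI : FiniteDimensional ℂ W := Submodule.finiteDimensional_of_le hW
  have hdW : d ≤ Module.finrank ℂ W := card_le_finrank_of_independent_mod hT hd hW hV u hu hind
  have hW' : Module.finrank ℂ W ≤ Module.finrank ℂ (T†.eigenspace I) := Submodule.finrank_mono hW
  have hWeq : W = T†.eigenspace I := Submodule.eq_of_le_of_finrank_eq hW (by omega)
  have hVr : LinearMap.range V.toLinearMap = T†.eigenspace (-I) := by
    have hle : LinearMap.range V.toLinearMap ≤ T†.eigenspace (-I) := by
      rintro _ ⟨w, rfl⟩
      exact hV w
    refine Submodule.eq_of_le_of_finrank_le hle ?_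
    rw [LinearMap.finrank_range_of_inj V.injective]
    omega
  exact (isSelfAdjoint_vnExtension_iff hT hc hd hW hV).2 ⟨hWeq, hVr⟩

/-- For `m₊(T) = m₋(T) = m < ∞`: **a symmetric extension of `T` by `m` vectors independent modulo
`dom T` is self-adjoint** (the square case of the previous statement). [cite: EdmundsEvans2018, Ch. III §4 Thm 4.8 with (4.11)] -/
theorem isSelfAdjoint_of_isSymmetric_of_independent_of_finrank_eq (hT : T.IsSymmetric) (hc : T.IsClosed)
    (hd : Dense (T.domain : Set H)) {m : ℕ}
    [FiniteDimensional ℂ (T†.eigenspace I)] [FiniteDimensional ℂ (T†.eigenspace (-I))]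
    (hp : Module.finrank ℂ (T†.eigenspace I) = m) (hm : Module.finrank ℂ (T†.eigenspace (-I)) = m)
    (hTS : T ≤ S) (hS : S.IsSymmetric) (u : Fin m → H) (hu : ∀ i, u i ∈ S.domain)
    (hind : ∀ c : Fin m → ℂ, ∑ i, c i • u i ∈ T.domain → c = 0) : IsSelfAdjoint S :=
  isSelfAdjoint_of_isSymmetric_of_independent hT hc hd hTS hS hp.le hm.le u hu hind

/-- **Self-adjoint operators are maximally symmetric**: a symmetric extension `B ⊇ A` of a
self-adjoint `A` IS `A` (`A ⊂ B ⊂ B* ⊂ A* = A`; «cannot be larger due to self-adjointness»).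
[cite: EdmundsEvans2018, Ch. III §4 Thm 4.8 (`T ⊂ S ⊂ S* ⊂ T*`); ConnesMoscovici2022, Thm 1.6 (iii), proof (= arXiv:2112.05500 Thm 2.6 (iii))] -/
theorem eq_of_isSelfAdjoint_of_le_of_isSymmetric {A B : H →ₗ.[ℂ] H} (hA : IsSelfAdjoint A)
    (hAB : A ≤ B) (hB : B.IsSymmetric) : A = B := by
  refine le_antisymm hAB ?_
  have h := le_adjoint_of_isSymmetric_of_le hA.dense_domain hAB hB
  rwa [LinearPMap.isSelfAdjoint_def.1 hA] at h

/-- In particular two self-adjoint operators, one extending the other, coincide.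
[cite: EdmundsEvans2018, Ch. III §4 Thm 4.8; ConnesMoscovici2022, Thm 1.6 (iii), proof (= arXiv:2112.05500 Thm 2.6 (iii))] -/
theorem eq_of_isSelfAdjoint_of_le {A B : H →ₗ.[ℂ] H} (hA : IsSelfAdjoint A) (hB : IsSelfAdjoint B)
    (hAB : A ≤ B) : A = B :=
  eq_of_isSelfAdjoint_of_le_of_isSymmetric hA hAB hB.isSymmetric_linearPMap

/-- **At most `m₊(T)` vectors of a symmetric extension are independent modulo `dom T`**
(`dim 𝒟(S)/𝒟(T) = dim 𝓘(V) ≤ m₊`). [cite: EdmundsEvans2018, Ch. III §4 Thm 4.8 (4.10)–(4.11), (4.13)] -/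
theorem card_le_finrank_deficiency_of_isSymmetric (hT : T.IsSymmetric) (hc : T.IsClosed)
    (hd : Dense (T.domain : Set H)) [FiniteDimensional ℂ (T†.eigenspace I)]
    (hTS : T ≤ S) (hS : S.IsSymmetric) {d : ℕ} (u : Fin d → H) (hu : ∀ i, u i ∈ S.domain)
    (hind : ∀ c : Fin d → ℂ, ∑ i, c i • u i ∈ T.domain → c = 0) :
    d ≤ Module.finrank ℂ (T†.eigenspace I) := by
  obtain ⟨W, V, hW, hV, rfl⟩ := exists_eq_vnExtension_of_isSymmetric hT hc hd hTS hS
  haveI : FiniteDimensional ℂ W := Submodule.finiteDimensional_of_le hW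
  exact (card_le_finrank_of_independent_mod hT hd hW hV u hu hind).trans (Submodule.finrank_mono hW)

/-- **A symmetric extension containing `m₊(T)` vectors independent modulo `dom T` is spanned by them
modulo `dom T`**: every `x ∈ dom S` is `x ≡ ∑ cᵢ uᵢ (mod dom T)` for a unique `c` — i.e.
`𝒟(S) = 𝒟(T) ∔ span{u₁, …, u_d}` ((4.10) with `dim 𝓘(V) = d`; the family `(x, u₁, …, u_d)` cannot be
independent modulo `dom T` by the previous count). [cite: EdmundsEvans2018, Ch. III §4 Thm 4.8 (4.10)–(4.11)] -/
theorem existsUnique_coeffs_of_isSymmetric (hT : T.IsSymmetric) (hc : T.IsClosed)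
    (hd : Dense (T.domain : Set H)) [FiniteDimensional ℂ (T†.eigenspace I)]
    (hTS : T ≤ S) (hS : S.IsSymmetric) {d : ℕ} (hdim : Module.finrank ℂ (T†.eigenspace I) ≤ d)
    (u : Fin d → H) (hu : ∀ i, u i ∈ S.domain)
    (hind : ∀ c : Fin d → ℂ, ∑ i, c i • u i ∈ T.domain → c = 0) {x : H} (hx : x ∈ S.domain) :
    ∃! c : Fin d → ℂ, x - ∑ i, c i • u i ∈ T.domain := by
  -- the family `(x, u₁, …, u_d)` of `d + 1` vectors of `dom S` is dependent modulo `dom T`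
  have hdep : ¬ ∀ c : Fin (d + 1) → ℂ,
      ∑ i, c i • (Fin.cons x u : Fin (d + 1) → H) i ∈ T.domain → c = 0 := by
    intro h
    have hle := card_le_finrank_deficiency_of_isSymmetric hT hc hd hTS hS (Fin.cons x u)
      (fun i => Fin.cases (by simpa using hx) (fun j => by simpa using hu j) i) h
    omega
  push Not at hdep
  obtain ⟨c, hcmem, hc0⟩ := hdep
  rw [Fin.sum_univ_succ] at hcmem
  simp only [Fin.cons_zero, Fin.cons_succ] at hcmem
  -- `hcmem : c 0 • x + ∑ i, c i.succ • u i ∈ dom T`, and `c 0 ≠ 0` by independence of the `uᵢ`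
  have hc00 : c 0 ≠ 0 := by
    intro h0
    rw [h0, zero_smul, zero_add] at hcmem
    have htail := hind _ hcmem
    apply hc0
    funext i
    refine Fin.cases h0 (fun j => ?_) i
    exact congrFun htail j
  set c₁ : Fin d → ℂ := fun i => -((c 0)⁻¹ * c i.succ) with hc₁
  have h₁ : x - ∑ i, c₁ i • u i ∈ T.domain := by
    have e : x - ∑ i, c₁ i • u i = (c 0)⁻¹ • (c 0 • x + ∑ i, c i.succ • u i) := by
      rw [smul_add, smul_smul, inv_mul_cancel₀ hc00, one_smul, Finset.smul_sum, sub_eq_add_neg,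
        ← Finset.sum_neg_distrib]
      congr 1
      refine Finset.sum_congr rfl fun i _ => ?_
      rw [hc₁, neg_smul, smul_smul, neg_neg]
    rw [e]
    exact Submodule.smul_mem _ _ hcmem
  refine ⟨c₁, h₁, fun c' hc' => ?_⟩
  -- uniqueness from independence
  have hdiff : ∑ i, (c' i - c₁ i) • u i ∈ T.domain := by
    have e : ∑ i, (c' i - c₁ i) • u i = (x - ∑ i, c₁ i • u i) - (x - ∑ i, c' i • u i) := by
      simp only [sub_smul, Finset.sum_sub_distrib]
      abel
    rw [e]
    exact Submodule.sub_mem _ h₁ hc'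
  have h := hind _ hdiff
  funext i
  exact sub_eq_zero.1 (congrFun h i)

end SymmetricExtension

/-! ### Self-adjoint boundary conditions: the domain of a self-adjoint extension as the annihilator,
under the boundary form `β⟦u, v⟧ = ⟪T†u, v⟫ − ⟪u, T†v⟫` (4.17), of `d = m±` isotropic vectors -/

section BoundaryConditions

omit [CompleteSpace H] in
/-- Two restrictions `A, B ≤ C` with `dom A ≤ dom B` satisfy `A ≤ B`. [cite: EdmundsEvans2018, Ch. III §4 Thm 4.8 (4.10) («the restriction of `T*` to `𝒟(T_V)`»)] -/
theorem le_of_le_of_le_of_domain_le {A B C : H →ₗ.[ℂ] H} (hA : A ≤ C) (hB : B ≤ C)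
    (hAB : A.domain ≤ B.domain) : A ≤ B := by
  refine ⟨hAB, fun x y hxy => ?_⟩
  have e1 : A x = C ⟨x, hA.1 x.2⟩ := hA.2 rfl
  have e2 : B y = C ⟨y, hB.1 y.2⟩ := hB.2 rfl
  rw [e1, e2]
  congr 1
  exact Subtype.ext hxy

/-- `β⟦u, v⟧ = 0 ⟹ β⟦v, u⟧ = 0` (`β⟦v, u⟧ = −conj β⟦u, v⟧`). [cite: EdmundsEvans2018, Ch. III §4 Thm 4.9 (4.16)–(4.17) with Thm 4.8 (4.10)–(4.11) and Cor 4.10 (ii)] -/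
theorem boundaryForm_eq_zero_symm (u v : T†.domain)
    (h : ⟪(T† u : H), (v : H)⟫_ℂ - ⟪(u : H), (T† v : H)⟫_ℂ = 0) :
    ⟪(T† v : H), (u : H)⟫_ℂ - ⟪(v : H), (T† u : H)⟫_ℂ = 0 := by
  rw [sub_eq_zero] at h ⊢
  rw [← inner_conj_symm, ← h, inner_conj_symm]

/-- `β⟦u, m + ∑ cₖ bₖ⟧ = ∑ cₖ β⟦u, bₖ⟧` for `m ∈ dom T` (the boundary form is linear in the second
slot and dies on `dom T`). [cite: EdmundsEvans2018, Ch. III §4 Thm 4.9 (4.16)–(4.17) with Thm 4.8 (4.10)–(4.11) and Cor 4.10 (ii)] -/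
theorem boundaryForm_right_of_eq_add_sum (hT : T.IsSymmetric) (hd : Dense (T.domain : Set H))
    {n : ℕ} (b : Fin n → H) (hb : ∀ k, b k ∈ T†.domain) (u : T†.domain) {v m : H}
    (hm : m ∈ T.domain) (c : Fin n → ℂ) (hv : v = m + ∑ k, c k • b k) (hvd : v ∈ T†.domain) :
    ⟪(T† u : H), v⟫_ℂ - ⟪(u : H), (T† ⟨v, hvd⟩ : H)⟫_ℂ =
      ∑ k, c k * (⟪(T† u : H), b k⟫_ℂ - ⟪(u : H), (T† ⟨b k, hb k⟩ : H)⟫_ℂ) := by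
  -- the boundary form against `u` as a linear functional on `dom T†`
  let B : ↥(T†.domain) →ₗ[ℂ] ℂ :=
    { toFun := fun y => ⟪(T† u : H), (y : H)⟫_ℂ - ⟪(u : H), (T† y : H)⟫_ℂ
      map_add' := fun y y' => by
        simp only [Submodule.coe_add, LinearPMap.map_add, inner_add_right]
        ring
      map_smul' := fun a y => by
        simp only [Submodule.coe_smul, LinearPMap.map_smul, inner_smul_right, smul_eq_mul,
          RingHom.id_apply]
        ring }
  have hB : ∀ y : T†.domain, B y = ⟪(T† u : H), (y : H)⟫_ℂ - ⟪(u : H), (T† y : H)⟫_ℂ :=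
    fun _ => rfl
  have hmd : m ∈ T†.domain := (le_adjoint_of_isSymmetric hT hd).1 hm
  set w : Fin n → ↥(T†.domain) := fun k => ⟨b k, hb k⟩ with hw
  have e : (⟨v, hvd⟩ : T†.domain) = ⟨m, hmd⟩ + ∑ k, c k • w k := by
    apply Subtype.ext
    simp [hw, hv]
  have h0 : B ⟨m, hmd⟩ = 0 := by
    rw [hB]
    exact inner_adjoint_sub_eq_zero_right hT hd u ⟨m, hmd⟩ hm
  calc ⟪(T† u : H), v⟫_ℂ - ⟪(u : H), (T† ⟨v, hvd⟩ : H)⟫_ℂ = B ⟨v, hvd⟩ := rfl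
    _ = B ⟨m, hmd⟩ + ∑ k, c k * B (w k) := by
        rw [e, _root_.map_add, _root_.map_sum]
        congr 1
        exact Finset.sum_congr rfl fun k _ => by rw [LinearMap.map_smul, smul_eq_mul]
    _ = ∑ k, c k * (⟪(T† u : H), b k⟫_ℂ - ⟪(u : H), (T† ⟨b k, hb k⟩ : H)⟫_ℂ) := by
        rw [h0, zero_add]
        exact Finset.sum_congr rfl fun k _ => by rw [hB]

variable {S : H →ₗ.[ℂ] H}

/-- **Self-adjoint boundary conditions (Thm 4.9 (4.16) read as a construction)**: let `T` be closed
symmetric densely defined with `m₊(T), m₋(T) ≤ d`, and let `b₁, …, b_d ∈ dom T†` be pairwise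
`β`-orthogonal (`β⟦bⱼ, bₖ⟧ = 0`) and linearly independent modulo `dom T`.  If `L ≤ dom T†` is their
`β`-annihilator (`ξ ∈ L ↔ ∀ k, β⟦ξ, bₖ⟧ = 0`), then the restriction `T†|_L` is SELF-ADJOINT and
`L = dom T ∔ span{b₁, …, b_d}` — the domain (4.10) of `T_V` is recovered as the set (4.16) of
`u ∈ 𝒟(T*)` with `β⟦u, φ₊ + Vφ₊⟧ = 0`.  (Mechanism: `U := dom T + span{bₖ}` is `β`-isotropic, so `T†|_U`
is a symmetric extension with `d` independent vectors, hence self-adjoint by the dimension count, and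
`L ⊆ 𝒟((T†|_U)*) = U ⊆ L`.) [cite: EdmundsEvans2018, Ch. III §4 Thm 4.9 (4.16)–(4.17) with Thm 4.8 (4.10)–(4.11) and Cor 4.10 (ii)] -/
theorem isSelfAdjoint_domRestrict_adjoint_of_annihilator (hT : T.IsSymmetric) (hc : T.IsClosed)
    (hd : Dense (T.domain : Set H))
    [FiniteDimensional ℂ (T†.eigenspace I)] [FiniteDimensional ℂ (T†.eigenspace (-I))] {d : ℕ}
    (hp : Module.finrank ℂ (T†.eigenspace I) ≤ d) (hm : Module.finrank ℂ (T†.eigenspace (-I)) ≤ d)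
    (b : Fin d → H) (hb : ∀ k, b k ∈ T†.domain)
    (hiso : ∀ j k, ⟪(T† ⟨b j, hb j⟩ : H), b k⟫_ℂ = ⟪b j, (T† ⟨b k, hb k⟩ : H)⟫_ℂ)
    (hind : ∀ c : Fin d → ℂ, ∑ k, c k • b k ∈ T.domain → c = 0)
    {L : Submodule ℂ H} (hL : L ≤ T†.domain)
    (hmem : ∀ ξ : T†.domain, (ξ : H) ∈ L ↔
      ∀ k, ⟪(T† ξ : H), b k⟫_ℂ = ⟪(ξ : H), (T† ⟨b k, hb k⟩ : H)⟫_ℂ) :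
    IsSelfAdjoint (T†.domRestrict L) ∧ L = T.domain ⊔ Submodule.span ℂ (Set.range b) := by
  have hTle : T ≤ T† := le_adjoint_of_isSymmetric hT hd
  set U : Submodule ℂ H := T.domain ⊔ Submodule.span ℂ (Set.range b) with hU
  have hbU : ∀ k, b k ∈ U := fun k => Submodule.mem_sup_right (Submodule.subset_span ⟨k, rfl⟩)
  have hUmax : U ≤ T†.domain :=
    sup_le hTle.1 (Submodule.span_le.2 (by rintro _ ⟨k, rfl⟩; exact hb k))
  have hUmem : ∀ {u : H}, u ∈ U → ∃ m ∈ T.domain, ∃ c : Fin d → ℂ, u = m + ∑ k, c k • b k := by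
    intro u hu
    obtain ⟨m, hm', s, hs, rfl⟩ := Submodule.mem_sup.1 hu
    obtain ⟨c, rfl⟩ := (Submodule.mem_span_range_iff_exists_fun ℂ).1 hs
    exact ⟨m, hm', c, rfl⟩
  -- `β⟦bₖ, u⟧ = 0` and `β⟦u, bₖ⟧ = 0` for `u ∈ U`, hence `β ≡ 0` on `U × U`
  have hβbU : ∀ (k) (u : T†.domain), (u : H) ∈ U →
      ⟪(T† ⟨b k, hb k⟩ : H), (u : H)⟫_ℂ - ⟪b k, (T† u : H)⟫_ℂ = 0 := by
    intro k u hu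
    obtain ⟨m, hm', c, hue⟩ := hUmem hu
    have h := boundaryForm_right_of_eq_add_sum hT hd b hb ⟨b k, hb k⟩ hm' c hue u.2
    rw [h]
    exact Finset.sum_eq_zero fun j _ => by rw [hiso k j, sub_self, mul_zero]
  have hβUb : ∀ (u : T†.domain) (k), (u : H) ∈ U →
      ⟪(T† u : H), b k⟫_ℂ - ⟪(u : H), (T† ⟨b k, hb k⟩ : H)⟫_ℂ = 0 :=
    fun u k hu => boundaryForm_eq_zero_symm ⟨b k, hb k⟩ u (hβbU k u hu)
  have hβU : ∀ (x y : T†.domain), (x : H) ∈ U → (y : H) ∈ U →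
      ⟪(T† x : H), (y : H)⟫_ℂ - ⟪(x : H), (T† y : H)⟫_ℂ = 0 := by
    intro x y hx hy
    obtain ⟨m', hm', c', hye⟩ := hUmem hy
    have h := boundaryForm_right_of_eq_add_sum hT hd b hb x hm' c' hye y.2
    rw [h]
    exact Finset.sum_eq_zero fun k _ => by rw [hβUb x k hx, mul_zero]
  -- `S := T†|_U` is a symmetric extension of `T` with `d` independent vectors: self-adjoint
  set S : H →ₗ.[ℂ] H := T†.domRestrict U with hS
  have hSdom : S.domain = U := by
    rw [hS, LinearPMap.domRestrict_domain]; exact inf_eq_left.2 hUmax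
  have hSle : S ≤ T† := LinearPMap.domRestrict_le
  have hTS : T ≤ S := le_of_le_of_le_of_domain_le hTle hSle (by rw [hSdom]; exact le_sup_left)
  have hSsym : S.IsSymmetric := by
    intro x y
    have hx : (x : H) ∈ U := by rw [← hSdom]; exact x.2
    have hy : (y : H) ∈ U := by rw [← hSdom]; exact y.2
    have ex : (S x : H) = T† ⟨x, hSle.1 x.2⟩ := hSle.2 rfl
    have ey : (S y : H) = T† ⟨y, hSle.1 y.2⟩ := hSle.2 rfl
    rw [ex, ey]
    exact sub_eq_zero.1 (hβU ⟨x, hSle.1 x.2⟩ ⟨y, hSle.1 y.2⟩ hx hy)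
  have hbS : ∀ k, b k ∈ S.domain := fun k => by rw [hSdom]; exact hbU k
  have hSA : IsSelfAdjoint S :=
    isSelfAdjoint_of_isSymmetric_of_independent hT hc hd hTS hSsym hp hm b hbS hind
  -- `L = U`
  have hLU : L = U := by
    apply le_antisymm
    · intro ξ hξ
      have hξd : ξ ∈ T†.domain := hL hξ
      have hk := (hmem ⟨ξ, hξd⟩).1 hξ
      have hξadj : ξ ∈ S†.domain := by
        refine LinearPMap.mem_adjoint_domain_of_exists ξ ⟨T† ⟨ξ, hξd⟩, fun u => ?_⟩
        have hu : (u : H) ∈ U := by rw [← hSdom]; exact u.2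
        have eu : (S u : H) = T† ⟨u, hSle.1 u.2⟩ := hSle.2 rfl
        rw [eu]
        obtain ⟨m', hm', c, hue⟩ := hUmem hu
        refine sub_eq_zero.1 ?_
        have h := boundaryForm_right_of_eq_add_sum hT hd b hb ⟨ξ, hξd⟩ hm' c hue (hSle.1 u.2)
        rw [h]
        exact Finset.sum_eq_zero fun k _ => by rw [hk k, sub_self, mul_zero]
      rw [LinearPMap.isSelfAdjoint_def.1 hSA, hSdom] at hξadj
      exact hξadj
    · intro u hu
      exact (hmem ⟨u, hUmax hu⟩).2 fun k => sub_eq_zero.1 (hβUb ⟨u, hUmax hu⟩ k hu)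
  refine ⟨?_, hLU⟩
  rw [hLU]
  exact hSA

end BoundaryConditions

end Literature.Analysis.UnboundedOperators
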